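import Summits.ValiantsHypothesis.ValiantsHypothesis.Theorems.BarrierLeverPartitionMinorsHitByVPHiddenStatesBallCutCertKitFast

/-!
# Route BarrierLever — item `PartitionMinorsHitByVP` (stmt-ValiantsHypothesis-19717), line `hidden-states`:
# ★★ THE CORES OF THE t = 4 CHART OF THE THIRD SHELL (support 12, part 3) — 20 totally unbalanced 3-swap classes served for every `h` (support 12: classes 42–61 of 61)

Helper file (`--supports stmt-ValiantsHypothesis-19717`, `--computational`; cell valiant-natproofs, 𝒟-side door (c), registered line
`Cruxes/PartitionMinorsHitByVP/Lines/hidden_states.lean` v10; prover seat val-np-p6 gen 22; planner SUCCESSOR MANDATE STATUS l.1830 (P2)).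
Closes NO item.  WHAT IS CHECKED: the CORES (classes without a g20 path certificate) of the chart of ALL totally unbalanced 3-swap families at `t = 4` up to
isomorphism (val-np-p6 g22 kit j333365: 607 994 classes, supports 6 … 27, 607 565 path-certified, 429 CORES of supports 6 … 15;
HOME/val-np-p6/g22/kit/cores_t4.txt, j333365.chart4-t4.stdout.log), restricted to the blocks
named in the title; each class is six naturals (binary codes of `A_0, A_1, A_2, C_0, C_1, C_2`) inside ONE string literal per block
(`level4Data_n_i`), one `native_decide` per block runs `certCheckList3N` (`…BallCutCertKitFast`: shape check + fast canonical table at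
`stdTable s n` mod 65521 + packed LU + val-np-p4 g30's verified checkers), and `exists_table_of_mem_parseClassesN` serves every coded class
for every `h` (`level4_served_n_i`).  HONEST LABEL: computational lane (`Lean.ofReduceBool`); «`S₃` at `t = 4` for every `h`» needs all
supports (same recipe: HOME/val-np-p6/g22/kit/gen_level_str.py) and the CLASSIFICATION as a Lean theorem; 19717 stays OPEN; nothing on
crux 14610 or VP ≠ VNP.
-/

set_option linter.dupNamespace false

namespace Summit.ValiantsHypothesis.ValiantsHypothesis.Theorems.BarrierLever.HiddenStates

open Finset

namespace BallCut

open SymbJoin MoorePeel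

/-- The t = 4 chart, support 12, classes 42–61 (of 61), coded: six naturals per class. -/
def level4Data_12_41 : String := "
3840 2704 338 3296 1228 817  3840 2704 1672 3296 286 793  3840 2704 464 3296 1102 817  3840 2704 464 3296 1132 787  3840 2704 1424 3296 110 793  3840 2704 1424 3296 110 849  3840 2704 1424 3296 856 47  3840 2704 1424 3296 880 79  3840 2832 202 3296 1676 361
3840 2832 202 3296 1676 1353  3840 2832 172 3296 1736 299  3840 3600 202 3296 412 345  3840 3600 3592 3296 2784 199  3840 3600 3592 3296 2784 1159  3840 3600 3592 3296 2784 1543  3840 2272 15 3776 1456 880  3840 2272 2062 3776 1456 865  3840 2944 1176 3296 542 285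
3840 2944 1232 3296 542 369  3840 2944 1232 3296 604 307
"

/-- **CERTIFICATE CHECK** for `level4Data_12_41` (20 classes, `794 × 794` matrices, seed 7; computational, `Lean.ofReduceBool`). -/
theorem level4Data_12_41_check : certCheckList3N 12 4 7 65521 (parseClasses level4Data_12_41) = true := by
  native_decide

/-- ★ Every class coded in `level4Data_12_41` is served, for every `h`. -/
theorem level4_served_12_41 (e : ℕ × ℕ × ℕ × ℕ × ℕ × ℕ) (he : e ∈ parseClasses level4Data_12_41) {h : ℕ} (σ : Fin 12 ↪ Fin h)
    {r : ℕ} (u cols : Fin r → Finset (Fin h)) (hu : Function.Injective u)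
    (hU : ∀ i, ((u i).card ≤ 4 ∧ ∀ j, u i ≠ (codedA 12 e j).map σ) ∨ ∃ j, u i = (codedC 12 e j).map σ)
    (hcols : ∀ J : Finset (Fin h), J.card ≤ 4 → ∃ k, cols k = J) :
    ∃ tx : Option (Fin h) → Fin h → ℂ,
      (Matrix.of fun i k : Fin r => ∏ a ∈ u i, (tx none a + ∑ q ∈ cols k, tx (some q) a)).det ≠ 0 :=
  exists_table_of_mem_parseClassesN 12 4 7 prime_65521 (by norm_num [packBase]) _ level4Data_12_41_check e he σ
    u cols hu hU hcols

end BallCut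

end Summit.ValiantsHypothesis.ValiantsHypothesis.Theorems.BarrierLever.HiddenStates
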